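import Mathlib
import Summits.Ventures.HodgeRepro2.T6N5Hyp
import Summits.Ventures.HodgeRepro2.T6N5LocalDatum
import Summits.Ventures.HodgeRepro2.T6N5LocalHyp
import Summits.Ventures.HodgeRepro2.T6N5Local
import Summits.Ventures.HodgeRepro2.T6N5LocalWeil
import Summits.Ventures.HodgeRepro2.T6N5LocalCharDatum
import Summits.Ventures.HodgeRepro2.T6N5LocalRamHyp
import Summits.Ventures.HodgeRepro2.T6N5LocalRam

/-!
# T6N5LocalRamWeil — Tier 6, M2 sub-step N5 (t6-p8's half): THEOREM N5.T2 at a ramified place with BOTH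
residual binders discharged — (A1) from the carried Weil representation (`T6N5LocalWeil`) and case (iii) from
Tate's (3.2.6.3) + Gan–Gross–Prasad's Proposition 5.1 (2) + conductor arithmetic (`T6N5LocalRam`)

`RamWeilDatum` = the ramified datum `R` together with the Weil representations of the two hermitian lines (the
fields of `T6N5LocalWeil.WeilLocalDatum` over `R`'s characters); `toWeil` is the `WeilLocalDatum` with
`base := R.toLocalSignDatum`, whose theta predicate is DEFINED from the Weil representation.
`N5Local_main_ram_weil` is `N5Local_main_of_weil` with its binder `hiii` supplied by `hiii_of_ramified` — so that at
a ramified place the coupled local system of TIER5 §N5.11.5 is solved from the three displays (Epsilon Dichotomy,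
Tate (3.2.6.3), Proposition 5.1 (2)) and DATUM conditions only: no interface residual remains.
README §8(d): uses an L-value-free non-vanishing device: NO.
-/

namespace Summit.Ventures.HodgeRepro2.T6.N5LocalRamWeil

open Summit.Ventures.HodgeRepro2.T6.N5LocalDatum Summit.Ventures.HodgeRepro2.T6.N5LocalWeil
  Summit.Ventures.HodgeRepro2.T6.N5LocalCharDatum Summit.Ventures.HodgeRepro2.T6.N5LocalCharDatum.CharDatum
  Summit.Ventures.HodgeRepro2.T6.N5LocalRamDatum
  Summit.Ventures.HodgeRepro2.T6.N5Local Summit.Ventures.HodgeRepro2.T6.N5LocalRam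
  Summit.Ventures.HodgeRepro2.T6.Hyp

/-- The ramified datum together with the carried Weil representations of the two hermitian lines (data only;
the Weil fields as in `T6N5LocalWeil.WeilLocalDatum`). -/
structure RamWeilDatum where
  /-- the concrete-character local sign datum at the ramified place. -/
  D : RamifiedSignDatum
  /-- `U(V) = E¹_v` as an additive abelian group. -/
  A : Type
  [instA : AddCommGroup A]
  /-- the space of the Weil representation of the line `V_s` restricted to `U(V_s)`. -/
  Wsp : ℤˣ → Type
  [instW : ∀ s, AddCommGroup (Wsp s)]
  [instWm : ∀ s, Module ℂ (Wsp s)]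
  /-- the Weil representation `ω_{V_s,W,ι̃,ψ}` restricted to `U(V_s) = E¹_v`. -/
  ωWeil : ∀ s, Representation ℂ (Multiplicative A) (Wsp s)
  /-- `α ↦ α_K = α ∘ j`. -/
  ofOne : AddChar A ℂ → (D.E →* ℂˣ)

attribute [instance] RamWeilDatum.instA RamWeilDatum.instW RamWeilDatum.instWm

namespace RamWeilDatum

variable (X : RamWeilDatum)

/-- The Weil local datum over the inert datum's local sign datum (theta predicate defined from the Weil
representation). -/
noncomputable abbrev toWeil : WeilLocalDatum where
  base := X.D.toLocalSignDatum
  A := X.A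
  Wsp := X.Wsp
  ωWeil := X.ωWeil
  ofOne := X.ofOne

/-- THEOREM N5.T2 AT A RAMIFIED PLACE, BOTH RESIDUALS DISCHARGED: the coupled local system is solvable from the
displays `Hyp.BFGYYZ2025_Thm3_5` (Epsilon Dichotomy), `Hyp.Tate1979_3_2_6_3` (the unramified twist) and
`Hyp.GGP2012_Prop5_1_2` (`ϵ(M,ψ)² = 1`) and the datum conditions of `T6N5LocalRam.N5Local_main_ramified` /
`T6N5LocalWeil.N5Local_main_of_weil`. -/
theorem N5Local_main_ram_weil (hT6 : Tate1979_3_2_6_3 X.D) (hG : GGP2012_Prop5_1_2 X.D) (hU : Antitone X.D.U)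
    (hω : X.D.IsUnramified (X.D.omega (1 / 2))) (hconj : X.D.IsConjInv X.D.ψδ)
    (hμ : ∃ μ : X.D.E →* ℂˣ, X.D.toLocalSignDatum.IsCO μ ∧ X.D.IsUnramified μ ∧ ((μ X.D.π : ℂˣ) : ℂ) = -1 ∧
      μ * μ = 1)
    (hodd : ∃ ωt : X.D.E →* ℂˣ, X.D.toLocalSignDatum.IsCS ωt ∧ X.D.IsSmooth ωt ∧ Odd (X.D.cond ωt))
    (heven : ∀ k : ℕ, ∃ β : X.D.E →* ℂˣ, X.D.toLocalSignDatum.IsCO β ∧ X.D.IsSmooth β ∧ Even (X.D.cond β) ∧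
      k < X.D.cond β)
    (h35 : BFGYYZ2025_Thm3_5 X.toWeil.toLocalSignDatum)
    (hsm : ∀ s, X.toWeil.IsSmoothCompact s) [∀ s, Nontrivial (X.Wsp s)]
    (hofOne : ∀ α, X.toWeil.toLocalSignDatum.IsCO (X.toWeil.ofOne α))
    (hW : X.toWeil.toLocalSignDatum.epsdW = 1)
    (hη : X.toWeil.toLocalSignDatum.η * X.toWeil.toLocalSignDatum.η = 1)
    (hχW : X.toWeil.toLocalSignDatum.IsCS X.toWeil.toLocalSignDatum.χW) :
    ∃ ξ : Fin 4 → X.toWeil.toLocalSignDatum.Char, LocalSolution X.toWeil.toLocalSignDatum ξ :=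
  X.toWeil.N5Local_main_of_weil h35 hsm hofOne hW hη hχW
    (fun _ _ => hiii_of_ramified X.D hT6 hG hU hω hconj hμ hodd heven)

end RamWeilDatum

end Summit.Ventures.HodgeRepro2.T6.N5LocalRamWeil
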